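import Summits.QuantumFields.YangMills.Theorems.LangevinControlUVOSLegsAtWeakCouplingCDefs
import Summits.QuantumFields.YangMills.Theorems.LangevinControlUVOSLegsFromFemtoAndGapStubAssemblyUniformBoundMain
import Summits.QuantumFields.YangMills.Theorems.LangevinControlUVOSLegsFromFemtoAndGapStubAssemblyPlaneExpansion
import HarnessLib

/-!
# Stub `stub_density` of line `Sketch` (crux `OSLegsAtWeakCouplingC`, stmt-QuantumFields-16207)

`theorem stub_density : Statement.stub_density` — **bounded densities of a soft-bundle limit off the big diagonal.**
Along any soft bundle `SoftBundle G r a sch S₁ Tq K b₀ g` the one-field limit `S₁ n` (`n ≥ 2`) is the limit of the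
centred curvature-density lattice distributions `latticeDist r.ρ β_k L_k a_k (tr F²) ⟨tr F²⟩ n`
`= Σ_{x ∈ (box L_k)ⁿ} W_k(x) δ_{a_k x}` on `⁰𝒮`.  For a compactly supported test function `F` (support in the sup-ball
of radius `ρ`) with `tsupport F ⊆ Separated n δ` (pairwise Euclidean distances `≥ δ`), a lattice multi-site `x`
contributes only if `a_k x ∈ tsupport F`; then its sites are pairwise `≥ δ/(2a_k)` apart in the sup norm of `ℤ⁴` and
sit in the bulk of the torus (`2‖xᵢ‖ ≤ L_k` once `2ρ ≤ a_k L_k`, no wrap-around), so the collar output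
`MomentBounds6 ⇒ MomentBounds` (toolkits IX, VI-a) at the collar radius `R` of `exists_collar_radius` for the
separation `δ/(2a_k) ≥ 6` (`1/R ≤ a_k (24/δ + 2/ℓ₄ + 24) =: a_k κ`) gives `|W_k(x)| ≤ (C/R⁴)ⁿ ≤ (C κ⁴)ⁿ a_k^{4n}`.
Hence `‖latticeDist_k F‖ ≤ (C κ⁴)ⁿ · a_k^{4n} Σ_x ‖F(a_k x)‖`, and the Riemann sums `a^{4n} Σ_{x ∈ (ℤ⁴)ⁿ} ‖F(a x)‖`
of the continuous compactly supported function `‖F‖` converge to `∫ ‖F‖` as `a = a_k → 0`, `a_k L_k → ∞`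
(`tendsto_riemann_sum`: the Riemann sum is the integral of the step function `y ↦ ‖F (a ⌊y/a⌋)‖`, dominated
convergence).  Passing to the limit: `‖S₁ n F‖ ≤ (C κ⁴)ⁿ ∫ ‖F‖`.  The arities `n = 0` (`S₁ 0 = ev`, the volume of
the one-point space `Fin 0 → ℝ⁴` is a Dirac mass) and `n = 1` (`S₁ 1 = 0`) are degenerate.

Refs: GlimmJaffe1987 §6.1 (lattice approximation and Riemann sums), OsterwalderSchrader1973 §2 (`⁰𝒮`).
-/

set_option autoImplicit false

noncomputable section

open scoped SchwartzMap BigOperators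
open MeasureTheory Filter Topology Metric
open Literature.MathematicalPhysics.QuantumFieldTheory Literature.MathematicalPhysics.QuantumLattice
open Literature.MathematicalPhysics.AQFT
open Literature.Probability.LatticeModels (box Site mem_box)
open Summit.QuantumFields.YangMills.Cruxes.OSLegsFromFemtoAndGap.DlrCollarTransfer
  (MomentBounds MomentBounds6 SoftBundle)
open Summit.QuantumFields.YangMills.Theorems.OSLegsFromFemtoAndGap

namespace Summit.QuantumFields.YangMills.Cruxes.OSLegsAtWeakCouplingC.Sketch

/-! ### Riemann sums on the scaled lattices `b (ℤ⁴)ᴺ`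

The cells `∏ᵢ ∏ⱼ [b xᵢⱼ, b xᵢⱼ + b)` (`x ∈ (ℤ⁴)ᴺ`) tile `(ℝ⁴)ᴺ`; they are written as set-builder expressions
throughout (no auxiliary definitions). -/

/-- The cell of the scaled lattice `b (ℤ⁴)ᴺ` labelled by `x` is measurable. -/
theorem measurableSet_cell {N : ℕ} (b : ℝ) (x : Fin N → Site 4) :
    MeasurableSet {y : Fin N → EuclideanSpace ℝ (Fin 4) | ∀ i j, b * x i j ≤ y i j ∧ y i j < b * x i j + b} := by
  have hm : ∀ (i : Fin N) (j : Fin 4), Measurable fun y : Fin N → EuclideanSpace ℝ (Fin 4) => y i j := fun i j =>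
    (measurable_pi_apply j).comp ((WithLp.measurable_ofLp 2 (Fin 4 → ℝ)).comp (measurable_pi_apply i))
  have hset : {y : Fin N → EuclideanSpace ℝ (Fin 4) | ∀ i j, b * x i j ≤ y i j ∧ y i j < b * x i j + b} =
      ⋂ i, ⋂ j, ({y : Fin N → EuclideanSpace ℝ (Fin 4) | b * x i j ≤ y i j} ∩
        {y : Fin N → EuclideanSpace ℝ (Fin 4) | y i j < b * x i j + b}) := by
    ext y
    simp only [Set.mem_setOf_eq, Set.mem_iInter, Set.mem_inter_iff]
  rw [hset]
  exact MeasurableSet.iInter fun i => MeasurableSet.iInter fun j =>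
    (measurableSet_le measurable_const (hm i j)).inter (measurableSet_lt (hm i j) measurable_const)

/-- The cell `∏ᵢ ∏ⱼ [b xᵢⱼ, b xᵢⱼ + b)` has volume `b^{4N}` (`b > 0`). -/
theorem volume_cell {N : ℕ} {b : ℝ} (hb : 0 < b) (x : Fin N → Site 4) :
    volume {y : Fin N → EuclideanSpace ℝ (Fin 4) | ∀ i j, b * x i j ≤ y i j ∧ y i j < b * x i j + b} =
      ENNReal.ofReal (b ^ (4 * N)) := by
  have hset : {y : Fin N → EuclideanSpace ℝ (Fin 4) | ∀ i j, b * x i j ≤ y i j ∧ y i j < b * x i j + b} =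
      Set.pi Set.univ fun i => (WithLp.ofLp : EuclideanSpace ℝ (Fin 4) → (Fin 4 → ℝ)) ⁻¹'
        Set.pi Set.univ fun j => Set.Ico (b * x i j) (b * x i j + b) := by
    ext y
    simp only [Set.mem_setOf_eq, Set.mem_univ_pi, Set.mem_preimage, Set.mem_Ico]
  have hfac : ∀ i : Fin N, volume ((WithLp.ofLp : EuclideanSpace ℝ (Fin 4) → (Fin 4 → ℝ)) ⁻¹'
      Set.pi Set.univ fun j => Set.Ico (b * x i j) (b * x i j + b)) = ENNReal.ofReal (b ^ 4) := by
    intro i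
    have hms : MeasurableSet (Set.pi Set.univ fun j : Fin 4 => Set.Ico (b * (x i j : ℝ)) (b * x i j + b)) :=
      MeasurableSet.univ_pi fun j => measurableSet_Ico
    rw [(PiLp.volume_preserving_ofLp (Fin 4)).measure_preimage hms.nullMeasurableSet, Real.volume_pi_Ico]
    simp only [add_sub_cancel_left, Finset.prod_const, Finset.card_univ, Fintype.card_fin]
    exact (ENNReal.ofReal_pow hb.le 4).symm
  rw [hset, volume_pi_pi, Finset.prod_congr rfl fun i _ => hfac i, Finset.prod_const, Finset.card_univ,
    Fintype.card_fin, ← ENNReal.ofReal_pow (by positivity), ← pow_mul]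

/-- `y` lies in the cell labelled by `x` iff `x` is the coordinatewise floor of `y / b`. -/
theorem mem_cell_iff {N : ℕ} {b : ℝ} (hb : 0 < b) (x : Fin N → Site 4) (y : Fin N → EuclideanSpace ℝ (Fin 4)) :
    (∀ i j, b * x i j ≤ y i j ∧ y i j < b * x i j + b) ↔ ∀ i j, x i j = ⌊y i j / b⌋ := by
  refine forall_congr' fun i => forall_congr' fun j => ?_
  rw [eq_comm, Int.floor_eq_iff, le_div_iff₀ hb, div_lt_iff₀ hb]
  constructor <;> rintro ⟨h1, h2⟩ <;> constructor <;> linarith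

/-- **The Riemann step function.** If the finite set `S ⊆ (ℤ⁴)ᴺ` contains every lattice multi-site at which
`g (b ·)` does not vanish, then `∑_{x ∈ S} g(b x) 1_{cell x}(y) = g (b ⌊y / b⌋)` for every `y`. -/
theorem sum_indicator_cell_eq {N : ℕ} {b : ℝ} (hb : 0 < b) (g : (Fin N → EuclideanSpace ℝ (Fin 4)) → ℝ)
    (S : Finset (Fin N → Site 4)) (hS : ∀ x : Fin N → Site 4, g (fun i => b • siteToE (x i)) ≠ 0 → x ∈ S)
    (y : Fin N → EuclideanSpace ℝ (Fin 4)) (x₀ : Fin N → Site 4) (hx₀ : ∀ i j, x₀ i j = ⌊y i j / b⌋) :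
    ∑ x ∈ S, {z : Fin N → EuclideanSpace ℝ (Fin 4) | ∀ i j, b * x i j ≤ z i j ∧ z i j < b * x i j + b}.indicator
        (fun _ => g (fun i => b • siteToE (x i))) y = g (fun i => b • siteToE (x₀ i)) := by
  classical
  have hmem : ∀ x : Fin N → Site 4,
      y ∈ {z : Fin N → EuclideanSpace ℝ (Fin 4) | ∀ i j, b * x i j ≤ z i j ∧ z i j < b * x i j + b} ↔ x = x₀ := by
    intro x
    rw [Set.mem_setOf_eq, mem_cell_iff hb]
    constructor
    · intro h
      funext i j
      rw [h i j, hx₀ i j]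
    · rintro rfl i j
      exact hx₀ i j
  by_cases h₀ : x₀ ∈ S
  · rw [Finset.sum_eq_single_of_mem x₀ h₀ (fun x _ hx => Set.indicator_of_notMem (mt (hmem x).1 hx) _)]
    exact Set.indicator_of_mem ((hmem x₀).2 rfl) _
  · have hzero : g (fun i => b • siteToE (x₀ i)) = 0 := by
      by_contra hne
      exact h₀ (hS x₀ hne)
    rw [hzero]
    refine Finset.sum_eq_zero fun x hx => Set.indicator_of_notMem (fun h => h₀ ?_) _
    rw [← (hmem x).1 h]
    exact hx

/-- **The integral of the Riemann step function is the Riemann sum**: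
`∫ ∑_{x ∈ S} c(x) 1_{cell x} = b^{4N} ∑_{x ∈ S} c(x)`. -/
theorem integral_sum_indicator_cell {N : ℕ} {b : ℝ} (hb : 0 < b) (c : (Fin N → Site 4) → ℝ)
    (S : Finset (Fin N → Site 4)) :
    ∫ y : Fin N → EuclideanSpace ℝ (Fin 4), ∑ x ∈ S,
        {z : Fin N → EuclideanSpace ℝ (Fin 4) | ∀ i j, b * x i j ≤ z i j ∧ z i j < b * x i j + b}.indicator
          (fun _ => c x) y = b ^ (4 * N) * ∑ x ∈ S, c x := by
  rw [integral_finsetSum S]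
  · rw [Finset.mul_sum]
    refine Finset.sum_congr rfl fun x _ => ?_
    rw [integral_indicator_const (c x) (measurableSet_cell b x), measureReal_def, volume_cell hb x,
      ENNReal.toReal_ofReal (by positivity), smul_eq_mul]
  · intro x _
    refine (integrable_indicator_iff (measurableSet_cell b x)).2 (integrableOn_const ?_)
    rw [volume_cell hb x]
    exact ENNReal.ofReal_ne_top

/-- The scaled floor point `b ⌊y / b⌋` is within `2b` of `y` (sup norm over the `N` points, Euclidean norm in
`ℝ⁴`). -/
theorem norm_floor_sub_le {N : ℕ} {b : ℝ} (hb : 0 < b) (y : Fin N → EuclideanSpace ℝ (Fin 4)) (x₀ : Fin N → Site 4)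
    (hx₀ : ∀ i j, x₀ i j = ⌊y i j / b⌋) : ‖(fun i => b • siteToE (x₀ i)) - y‖ ≤ 2 * b := by
  refine (pi_norm_le_iff_of_nonneg (by positivity)).2 fun i => ?_
  rw [Pi.sub_apply, EuclideanSpace.norm_eq]
  have hcoord : ∀ j, ‖(b • siteToE (x₀ i) - y i) j‖ ^ 2 ≤ b ^ 2 := by
    intro j
    have h1 : (b • siteToE (x₀ i) - y i) j = b * ⌊y i j / b⌋ - y i j := by
      simp [siteToE_apply, hx₀]
    have h2 : ((⌊y i j / b⌋ : ℤ) : ℝ) ≤ y i j / b := Int.floor_le _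
    have h3 : y i j / b < (⌊y i j / b⌋ : ℤ) + 1 := Int.lt_floor_add_one _
    rw [le_div_iff₀ hb] at h2
    rw [div_lt_iff₀ hb] at h3
    have h4 : |b * ⌊y i j / b⌋ - y i j| ≤ b := by
      rw [abs_le]
      constructor <;> linarith
    rw [h1, Real.norm_eq_abs]
    exact pow_le_pow_left₀ (abs_nonneg _) h4 2
  calc Real.sqrt (∑ j, ‖(b • siteToE (x₀ i) - y i) j‖ ^ 2) ≤ Real.sqrt (∑ _j : Fin 4, b ^ 2) :=
        Real.sqrt_le_sqrt (Finset.sum_le_sum fun j _ => hcoord j)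
    _ = 2 * b := by
        rw [Finset.sum_const, Finset.card_univ, Fintype.card_fin, nsmul_eq_mul,
          show ((4 : ℕ) : ℝ) * b ^ 2 = (2 * b) ^ 2 by push_cast; ring]
        exact Real.sqrt_sq (by positivity)

/-- **Riemann sums of a continuous compactly supported function on `(ℝ⁴)ᴺ`.**  If `a_k > 0`, `a_k → 0` and
`a_k L_k → ∞`, then `a_k^{4N} ∑_{x ∈ (box L_k)ᴺ} g(a_k x) → ∫ g`: the Riemann sum is the integral of the step function
`y ↦ g (a_k ⌊y / a_k⌋)` once the box contains every cell meeting the support (`a_k L_k ≥ ρ`), these step functions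
converge pointwise to `g` (continuity, `‖a ⌊y/a⌋ − y‖ ≤ 2a`) and are dominated by `‖g‖_∞ 1_{B(0, ρ+1)}`
(`2 a_k ≤ 1`). -/
theorem tendsto_riemann_sum {N : ℕ} (g : (Fin N → EuclideanSpace ℝ (Fin 4)) → ℝ) (hg : Continuous g)
    (hgc : HasCompactSupport g)
    (a : ℕ → ℝ) (L : ℕ → ℕ) (ha : ∀ k, 0 < a k) (ha0 : Tendsto a atTop (𝓝 0))
    (haL : Tendsto (fun k => a k * L k) atTop atTop) :
    Tendsto (fun k => a k ^ (4 * N) * ∑ x ∈ Fintype.piFinset (fun _ : Fin N => box 4 (L k)),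
      g (fun i => a k • siteToE (x i))) atTop (𝓝 (∫ y, g y)) := by
  classical
  -- a support radius `ρ ≥ 0` and a sup bound `M`
  obtain ⟨ρ, hρ0, hρ⟩ : ∃ ρ : ℝ, 0 ≤ ρ ∧ tsupport g ⊆ closedBall (0 : Fin N → EuclideanSpace ℝ (Fin 4)) ρ := by
    obtain ⟨ρ, hρ⟩ := hgc.isCompact.isBounded.subset_closedBall 0
    exact ⟨max ρ 0, le_max_right _ _, hρ.trans (closedBall_subset_closedBall (le_max_left _ _))⟩
  obtain ⟨M, hM⟩ := hg.bounded_above_of_compact_support hgc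
  -- the floor map
  obtain ⟨fl, hfl⟩ :
      ∃ fl : ℝ → (Fin N → EuclideanSpace ℝ (Fin 4)) → (Fin N → Site 4), ∀ b y i j, fl b y i j = ⌊y i j / b⌋ :=
    ⟨fun b y i j => ⌊y i j / b⌋, fun _ _ _ _ => rfl⟩
  -- pointwise convergence of `g (a_k ⌊y / a_k⌋)` to `g y`
  have h_lim : ∀ y : Fin N → EuclideanSpace ℝ (Fin 4),
      Tendsto (fun k => g (fun i => a k • siteToE (fl (a k) y i))) atTop (𝓝 (g y)) := by
    intro y
    refine (hg.tendsto y).comp ?_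
    rw [tendsto_iff_norm_sub_tendsto_zero]
    refine squeeze_zero (fun k => norm_nonneg _) (fun k => norm_floor_sub_le (ha k) y _ (hfl (a k) y)) ?_
    simpa using ha0.const_mul 2
  -- covering: eventually every lattice multi-site seen by `g` lies in the box
  have hcover : ∀ᶠ k in atTop, ∀ x : Fin N → Site 4, g (fun i => a k • siteToE (x i)) ≠ 0 →
      x ∈ Fintype.piFinset (fun _ : Fin N => box 4 (L k)) := by
    filter_upwards [haL.eventually_ge_atTop ρ] with k hk x hx
    have hy : (fun i => a k • siteToE (x i)) ∈ closedBall (0 : Fin N → EuclideanSpace ℝ (Fin 4)) ρ :=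
      hρ (subset_tsupport _ (Function.mem_support.2 hx))
    rw [mem_closedBall, dist_zero_right] at hy
    refine Fintype.mem_piFinset.2 fun i => mem_box.2 fun j => ?_
    have h1 : a k * ‖x i‖ ≤ ρ :=
      (mul_norm_le_norm_smul_siteToE (ha k).le (x i)).trans ((norm_le_pi_norm _ i).trans hy)
    have h2 : (‖x i j‖ : ℝ) ≤ ‖x i‖ := norm_le_pi_norm (x i) j
    rw [Int.norm_eq_abs] at h2
    have h3 : a k * |(x i j : ℝ)| ≤ a k * (L k : ℝ) := by
      have := mul_le_mul_of_nonneg_left h2 (ha k).le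
      linarith
    have h4 := abs_le.1 (le_of_mul_le_mul_left h3 (ha k))
    exact ⟨by exact_mod_cast h4.1, by exact_mod_cast h4.2⟩
  -- the step functions, eventually
  have hstep : ∀ᶠ k in atTop, (fun y => g (fun i => a k • siteToE (fl (a k) y i))) = fun y =>
      ∑ x ∈ Fintype.piFinset (fun _ : Fin N => box 4 (L k)),
        {z : Fin N → EuclideanSpace ℝ (Fin 4) | ∀ i j, a k * x i j ≤ z i j ∧ z i j < a k * x i j + a k}.indicator
          (fun _ => g (fun i => a k • siteToE (x i))) y := by
    filter_upwards [hcover] with k hk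
    exact funext fun y => (sum_indicator_cell_eq (ha k) g _ hk y (fl (a k) y) (hfl (a k) y)).symm
  -- dominated convergence
  have hDCT : Tendsto (fun k => ∫ y, g (fun i => a k • siteToE (fl (a k) y i))) atTop (𝓝 (∫ y, g y)) := by
    refine tendsto_integral_filter_of_dominated_convergence
      (fun y => (closedBall (0 : Fin N → EuclideanSpace ℝ (Fin 4)) (ρ + 1)).indicator (fun _ => M) y) ?_ ?_ ?_ ?_
    · filter_upwards [hstep] with k hk
      rw [hk]
      refine Finset.aestronglyMeasurable_fun_sum _ fun x _ => ?_
      exact aestronglyMeasurable_const.indicator (measurableSet_cell (a k) x)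
    · filter_upwards [ha0.eventually (ge_mem_nhds (by norm_num : (0 : ℝ) < 1 / 2))] with k hk
      refine Eventually.of_forall fun y => ?_
      by_cases hy : y ∈ closedBall (0 : Fin N → EuclideanSpace ℝ (Fin 4)) (ρ + 1)
      · rw [Set.indicator_of_mem hy]
        exact hM _
      · rw [Set.indicator_of_notMem hy]
        have hzero : g (fun i => a k • siteToE (fl (a k) y i)) = 0 := by
          by_contra hne
          have hz : (fun i => a k • siteToE (fl (a k) y i)) ∈ closedBall (0 : Fin N → EuclideanSpace ℝ (Fin 4)) ρ :=
            hρ (subset_tsupport _ (Function.mem_support.2 hne))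
          rw [mem_closedBall, dist_zero_right] at hz
          have hd := norm_floor_sub_le (ha k) y _ (hfl (a k) y)
          refine hy ?_
          rw [mem_closedBall, dist_zero_right]
          calc ‖y‖ = ‖(fun i => a k • siteToE (fl (a k) y i)) -
                ((fun i => a k • siteToE (fl (a k) y i)) - y)‖ := by rw [sub_sub_cancel]
            _ ≤ ‖(fun i => a k • siteToE (fl (a k) y i))‖ +
                ‖(fun i => a k • siteToE (fl (a k) y i)) - y‖ := norm_sub_le _ _
            _ ≤ ρ + 1 := by linarith
        rw [hzero, norm_zero]
    · exact (integrable_indicator_iff measurableSet_closedBall).2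
        (integrableOn_const (isCompact_closedBall _ _).measure_lt_top.ne)
    · exact Eventually.of_forall h_lim
  -- the integrals of the step functions are the Riemann sums
  refine hDCT.congr' ?_
  filter_upwards [hstep] with k hk
  rw [hk, integral_sum_indicator_cell (ha k)]

/-! ### The stub -/

/-- Registered stub `stub_density`: along any soft bundle `SoftBundle G r a sch S₁ Tq K b₀ g` in units carrying the
plane-resolved collar output `MomentBounds6 G r a`, the one-field limit `S₁` has bounded densities off the big
diagonal (`OffDiagDensity S₁`): for every arity `n` and `δ > 0` there is `B` with `‖S₁ n F‖ ≤ B ∫ ‖F‖` for all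
compactly supported `F` with `tsupport F ⊆ Separated n δ`.  For `n ≥ 2`, `B = (6C (24/δ + 2/ℓ₄ + 24)⁴)ⁿ` with the
`MomentBounds6` constants `C, ℓ₄`; `n = 0, 1` are degenerate (`S₁ 0 = ev`, `S₁ 1 = 0`). -/
theorem stub_density : Statement.stub_density := by
  intro G _ _ _ _ _ _ r a sch S₁ Tq K b₀ g hMB6 hSB
  classical
  obtain ⟨⟨hunits, -, -, hβ, -, -, -, -, hS0, hS1, hconv, -, -, -, -, -, hranges, -, -, -, -⟩, -⟩ := hSB
  intro n δ hδ
  rcases n with _ | _ | n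
  · -- arity 0: `S₁ 0 F = F default` and the volume of the one-point space is a Dirac mass
    refine ⟨1, fun F _ _ => ?_⟩
    have hint : ∫ x : Fin 0 → EuclideanSpace ℝ (Fin 4), ‖F x‖ = ‖F default‖ := by
      rw [Measure.volume_pi_eq_dirac (default : Fin 0 → EuclideanSpace ℝ (Fin 4)), integral_dirac]
    rw [hS0, one_mul, hint]
  · -- arity 1: `S₁ 1 = 0`
    refine ⟨0, fun F _ _ => ?_⟩
    rw [hS1, norm_zero, zero_mul]
  · -- arity `N = n + 2`
    obtain ⟨C, β₄, ℓ₄, hℓ, hC, H⟩ :=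
      abs_torusMoment_le_of_momentBounds r (momentBounds_of_momentBounds6 r a hMB6)
    set N : ℕ := n + 1 + 1 with hN
    have hN2 : 2 ≤ N := by omega
    set κ : ℝ := 24 / δ + 2 / ℓ₄ + 24 with hκ
    have hκ0 : 0 < κ := by positivity
    refine ⟨(C * κ ^ 4) ^ N, fun F hFc hFs => ?_⟩
    -- `F` is off-diagonal: its support avoids the coincidence locus
    have hFoff : IsOffDiagonal F := by
      refine IsOffDiagonal.of_tsupport_subset fun y hy hcoin => ?_
      obtain ⟨i, j, hij, hyij⟩ := (mem_coincidenceLocus y).1 hcoin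
      have h : δ ≤ dist (y i) (y j) := hFs hy i j hij
      rw [hyij, dist_self] at h
      exact absurd h (not_le.2 hδ)
    -- a support radius
    obtain ⟨ρ, hρ0, hρ⟩ : ∃ ρ : ℝ, 0 ≤ ρ ∧ tsupport (F : (Fin N → EuclideanSpace ℝ (Fin 4)) → ℂ) ⊆
        closedBall (0 : Fin N → EuclideanSpace ℝ (Fin 4)) ρ := by
      obtain ⟨ρ, hρ⟩ := hFc.isCompact.isBounded.subset_closedBall 0
      exact ⟨max ρ 0, le_max_right _ _, hρ.trans (closedBall_subset_closedBall (le_max_left _ _))⟩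
    -- the two limits: lattice distributions → `S₁ N F`, Riemann sums → `∫ ‖F‖`
    have hlim : Tendsto (fun k => ‖latticeDist r.ρ (sch.β k) (sch.L k) (sch.a k) r.curvature.F
        (wilsonTorusMean r.ρ (sch.β k) (sch.L k) r.curvature.F) N F‖) atTop (𝓝 ‖S₁ N F‖) :=
      (hconv N hN2 F hFoff).norm
    have hRiem : Tendsto (fun k => sch.a k ^ (4 * N) *
        ∑ x ∈ Fintype.piFinset (fun _ : Fin N => box 4 (sch.L k)), ‖F (fun i => sch.a k • siteToE (x i))‖)
        atTop (𝓝 (∫ y, ‖F y‖)) :=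
      tendsto_riemann_sum (fun y => ‖F y‖) F.continuous.norm hFc.norm sch.a sch.L sch.a_pos sch.tendsto_a
        sch.tendsto_L
    -- eventual domination of the lattice distributions by the Riemann sums
    have hev : ∀ᶠ k in atTop, ‖latticeDist r.ρ (sch.β k) (sch.L k) (sch.a k) r.curvature.F
        (wilsonTorusMean r.ρ (sch.β k) (sch.L k) r.curvature.F) N F‖ ≤
        (C * κ ^ 4) ^ N * (sch.a k ^ (4 * N) *
          ∑ x ∈ Fintype.piFinset (fun _ : Fin N => box 4 (sch.L k)), ‖F (fun i => sch.a k • siteToE (x i))‖) := by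
      have hε : 0 < min (min 1 ℓ₄) (δ / 12) := lt_min (lt_min one_pos hℓ) (by positivity)
      filter_upwards [hβ.eventually_ge_atTop β₄, sch.tendsto_a.eventually (gt_mem_nhds hε),
        sch.tendsto_L.eventually_ge_atTop (2 * ρ)] with k hkβ hka hkL
      have hapos : 0 < sch.a k := sch.a_pos k
      have ha1 : sch.a k ≤ 1 := (hka.le.trans (min_le_left _ _)).trans (min_le_left _ _)
      have haℓ : sch.a k ≤ ℓ₄ := (hka.le.trans (min_le_left _ _)).trans (min_le_right _ _)
      have haδ : sch.a k * 12 ≤ δ := by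
        have := hka.le.trans (min_le_right _ _)
        rwa [le_div_iff₀ (by norm_num : (0 : ℝ) < 12)] at this
      obtain ⟨-, -, hL14, hLa⟩ := hranges k
      -- collar radius for the lattice separation `δ / (2 a_k) ≥ 6`
      have hδ6 : 6 ≤ δ / (2 * sch.a k) := by
        rw [le_div_iff₀ (by positivity)]
        linarith
      obtain ⟨R, hR1, hRa, hRL, hRδ, hRinv⟩ := exists_collar_radius hδ6 hℓ hapos ha1 haℓ hL14 hLa
      have hRpos : (0 : ℝ) < R := by exact_mod_cast hR1
      have hRinv' : (R : ℝ)⁻¹ ≤ sch.a k * κ := by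
        have : 12 / (δ / (2 * sch.a k)) + sch.a k * (2 / ℓ₄ + 24) = sch.a k * κ := by
          rw [hκ, div_div_eq_mul_div]
          ring
        rw [← this]
        exact hRinv
      -- the collar bound at the lattice multi-sites seen by `F`
      have hW : ∀ x : Fin N → Site 4, F (fun i => sch.a k • siteToE (x i)) ≠ 0 →
          |torusMoment r.ρ (sch.β k) (sch.L k) r.curvature.F
              (wilsonTorusMean r.ρ (sch.β k) (sch.L k) r.curvature.F) x| ≤
            (C * κ ^ 4) ^ N * sch.a k ^ (4 * N) := by
        intro x hx
        have hy : (fun i => sch.a k • siteToE (x i)) ∈ tsupport (F : (Fin N → EuclideanSpace ℝ (Fin 4)) → ℂ) :=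
          subset_tsupport _ (Function.mem_support.2 hx)
        -- no wrap-around: all sites in the bulk of the torus
        have hwrap : ∀ i, 2 * ‖x i‖ ≤ (sch.L k : ℝ) := by
          intro i
          have h1 := hρ hy
          rw [mem_closedBall, dist_zero_right] at h1
          have h2 : sch.a k * ‖x i‖ ≤ ρ :=
            (mul_norm_le_norm_smul_siteToE hapos.le (x i)).trans ((norm_le_pi_norm _ i).trans h1)
          have h3 : sch.a k * (2 * ‖x i‖) ≤ sch.a k * (sch.L k : ℝ) := by linarith
          exact le_of_mul_le_mul_left h3 hapos
        -- lattice sup-separation `≥ δ / (2 a_k) ≥ 2R + 4`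
        have hsepx : ∀ i j : Fin N, i ≠ j → 2 * (R : ℝ) + 4 ≤ ‖x i - x j‖ := by
          intro i j hij
          have h1 : δ ≤ dist (sch.a k • siteToE (x i)) (sch.a k • siteToE (x j)) := hFs hy i j hij
          rw [dist_eq_norm] at h1
          have h2 := norm_smul_siteToE_sub_le hapos.le (x i) (x j)
          have h3 : δ / (2 * sch.a k) ≤ ‖x i - x j‖ := by
            rw [div_le_iff₀ (by positivity)]
            linarith
          exact hRδ.trans h3
        have hsep : ∀ i j : Fin N, i ≠ j → ∃ l : Fin 4,
            (2 * (R : ℤ) + 4) ≤ |((((x i l - x j l : ℤ) : ZMod (2 * sch.L k + 1))).valMinAbs : ℤ)| := by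
          intro i j hij
          obtain ⟨l, hl⟩ := exists_valMinAbs_ge_of_norm_le x hwrap i j (hsepx i j hij)
          exact ⟨l, by exact_mod_cast hl⟩
        have hRa' : (R : ℝ) * a (sch.β k) ≤ ℓ₄ := by
          rw [← hunits k]
          exact hRa
        have h1 := H (sch.β k) hkβ (sch.L k) N x R hR1 hRa' hRL hsep
        have h2 : C / (R : ℝ) ^ 4 ≤ C * κ ^ 4 * sch.a k ^ 4 := by
          have h3 : ((R : ℝ)⁻¹) ^ 4 ≤ (sch.a k * κ) ^ 4 :=
            pow_le_pow_left₀ (inv_nonneg.2 hRpos.le) hRinv' 4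
          calc C / (R : ℝ) ^ 4 = C * ((R : ℝ)⁻¹) ^ 4 := by rw [div_eq_mul_inv, inv_pow]
            _ ≤ C * (sch.a k * κ) ^ 4 := mul_le_mul_of_nonneg_left h3 hC
            _ = C * κ ^ 4 * sch.a k ^ 4 := by ring
        calc _ ≤ (C / (R : ℝ) ^ 4) ^ N := h1
          _ ≤ (C * κ ^ 4 * sch.a k ^ 4) ^ N :=
              pow_le_pow_left₀ (div_nonneg hC (pow_nonneg hRpos.le 4)) h2 N
          _ = (C * κ ^ 4) ^ N * sch.a k ^ (4 * N) := by rw [mul_pow, pow_mul]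
      -- sum over the torus
      rw [latticeDist_apply]
      refine (norm_sum_le _ _).trans ?_
      calc ∑ x ∈ Fintype.piFinset (fun _ : Fin N => box 4 (sch.L k)),
            ‖((torusMoment r.ρ (sch.β k) (sch.L k) r.curvature.F
                (wilsonTorusMean r.ρ (sch.β k) (sch.L k) r.curvature.F) x : ℝ) : ℂ) *
              F (fun i => sch.a k • siteToE (x i))‖
          ≤ ∑ x ∈ Fintype.piFinset (fun _ : Fin N => box 4 (sch.L k)),
            (C * κ ^ 4) ^ N * sch.a k ^ (4 * N) * ‖F (fun i => sch.a k • siteToE (x i))‖ := by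
            refine Finset.sum_le_sum fun x _ => ?_
            rw [norm_mul, Complex.norm_real, Real.norm_eq_abs]
            by_cases hx : F (fun i => sch.a k • siteToE (x i)) = 0
            · simp [hx]
            · exact mul_le_mul_of_nonneg_right (hW x hx) (norm_nonneg _)
        _ = (C * κ ^ 4) ^ N * (sch.a k ^ (4 * N) *
            ∑ x ∈ Fintype.piFinset (fun _ : Fin N => box 4 (sch.L k)), ‖F (fun i => sch.a k • siteToE (x i))‖) := by
            rw [Finset.mul_sum, Finset.mul_sum]
            exact Finset.sum_congr rfl fun x _ => by ring
    exact le_of_tendsto_of_tendsto hlim (hRiem.const_mul _) hev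

end Summit.QuantumFields.YangMills.Cruxes.OSLegsAtWeakCouplingC.Sketch

end
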